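import Mathlib
import HarnessLib
import Summits.HubbardSuperconductivity.HubbardSuperconductivity.Theorems.KLProgrammeKLRegimeEngineTowerRemeasureWtAbs
import Summits.HubbardSuperconductivity.HubbardSuperconductivity.Theorems.KLProgrammeKLRegimeOverlapWtJumpFlowAll

/-!
# Route `KLProgramme` — crux K3 ENGINE (stmt-HubbardSuperconductivity-20437 `KLRegimeEngineV17F2`), stub (b) v2, THE LEVELS PACKAGE (ℓ), instantiation (I2),
# THE WEIGHTED JUMP ROWS AT THE FLOW FRAME WITH NO DEPTH WINDOW — the `_flow_all` re-keys (X3) of the located item «(I2)-WT-WINDOW»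

Cell gate-hubbard-kl, seat p4 g17 (re-keys agreed with the owner k3c2-p3 g12, KL STATUS 2026-08-28 15:43Z).  k3c2-p3's `klWtPinnedSumAt_jump_le_klEng_flow_deep` /
`klWtPinnedSumAt_klTowerIncr_remeasure_le_klEng_flow_deep` (…EngineTowerRemeasureWt §3/§4) and p4's `…_abs` twins (…EngineTowerRemeasureWtAbs,
…EngineTowerRemeasureSum) read p3's `overlapWt_jump_sums_klEng_flow_deep (dd)` and therefore bind the deep window `4ⁿ·U ≤ 4^{2(k+1)+dd}` at the COARSE
family — no supplier for old increments / the UV datum at deep frames.  Here the same compositions read the window-free `overlapWt_jump_sums_klEng_flow_all (R) (c″)`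
(…OverlapWtJumpFlowAll): W5's binder list (`c″U ≤ 1`, `1 ≤ n ≤ n_β + 1`, `IsKLRegime U cc (−n)`, `HistP … 0 n`, the REGISTERED (K5′) clauses
`∀ m, 1 ≤ m → m < n → FlowPieceOscAt … c″ … m`) + the count's thresholds; NO window, NO `FrameOK` binder (from the history, `frameOK_klFlowFrameU_of_histP_le`);
the constant depends on `(R, c″)` through `c″ + Gfr₁ + Gfr₂ + Gfr₃ + 1` only:

* **`klWtPinnedSumAt_jump_le_klEng_flow_all (m) (R) (c″)`** — the weighted jump, relative count with one determined leg: `≤ C·(2^{J′−k})^{m−1}·N`, every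
  `k + 1 ≤ J′ ≤ n`, rate `j ≥ J′`;
* **`klWtPinnedSumAt_klTowerIncr_remeasure_le_klEng_flow_all (m) (R) (c″)`** — the increment `Δ_{k′}` re-measured at `F_{dk−1}`: `≤ C·(2^{dk−1−dk′})^{m−1}·klTowerBornWtAt …`;
* **`klWtPinnedSumAt_jump_le_klEng_flow_all_abs (m) (5 ≤ m) (R) (c″)`** — the absolute count with the second conservation gain: `≤ C·(2^{J′})^{m−2}·N`;
* **`klWtPinnedSumAt_scaleZero_remeasure_le_klEng_flow_all_abs`** — THE UV SUMMAND `𝒱_0[K_n]` at `F_{J′}`, every `1 ≤ J′ ≤ n`: `≤ C·(2^{J′})^{m−2}·N₀`;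
* **`klWtPinnedSumAt_klTowerIncr_remeasure_le_klEng_flow_all_abs`** — `Δ_{k′}` (load-bearing at `k′ = 0`, born at `F_0`): `≤ C·(2^{dk−1})^{m−2}·klTowerBornWtAt …`.
Everything is proved; no definitions; nothing about the model is asserted; nothing asserts superconductivity.
References: BGM 2006 §2.7 (2.71a), §2.8 (2.76), (2.82)–(2.84), (2.88)–(2.90), §3 (3.2)–(3.8), App. A3 [cite: BenfattoGiulianiMastropietro2006]; BGM 2003 §3.1
Lemma 3.1 (4.3) [cite: BenfattoGiulianiMastropietro2003].
-/

noncomputable section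

namespace Summit.HubbardSuperconductivity.HubbardSuperconductivity.Theorems.EngineV8

set_option linter.dupNamespace false -- summit = problem name (single-conjunct summit), D-0017

open Classical
open Real Finset Literature.MathematicalPhysics.QuantumLattice Literature.Probability.LatticeModels GrassmannAlgebra
open Literature.Probability.LatticeModels.BattleFederbush
open Literature.MathematicalPhysics.QuantumLattice.FermiRG
open Summit.HubbardSuperconductivity.HubbardSuperconductivity.Theorems.KLRegimeSplit
open Summit.HubbardSuperconductivity.HubbardSuperconductivity.Theorems.KLProgrammeLegKernels
open Summit.HubbardSuperconductivity.HubbardSuperconductivity.Theorems.DispersionFlow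
open Summit.HubbardSuperconductivity.HubbardSuperconductivity.Theorems.KLRegimeWick
open Summit.HubbardSuperconductivity.HubbardSuperconductivity.Theorems.TorusFourierL2
open Summit.HubbardSuperconductivity.HubbardSuperconductivity.Theorems.PerturbedFermiCurve

/-! ## §1 The weighted jump, one determined leg, no window -/

/-- **THE WEIGHTED JUMP IN THE KL REGIME AT THE FLOW FRAME, NO DEPTH WINDOW** — k3c2-p3's `klWtPinnedSumAt_jump_le_klEng_flow_deep` with p3's windowed overlap
replaced by `overlapWt_jump_sums_klEng_flow_all`: for every number of legs `m + 1` there is `C_m(R, c″) > 0` with, for every `k + 1 ≤ J′ ≤ n`, momentum-conserving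
`T`, rate `j ≥ J′`, pinned leg, pin and bound `N` of the coarse carriers, `klWtPinnedSumAt … J′ j (m+1) T q w ≤ C·(2^{J′−k})^{m−1}·N` at `K = K_n`.
[cite: BenfattoGiulianiMastropietro2006, §2.8 (2.82)-(2.84), (2.88)-(2.90), §3 (3.2)-(3.8)] -/
theorem klWtPinnedSumAt_jump_le_klEng_flow_all (m : ℕ) (R : RenConsts) (c'' : ℝ) (hc'' : 0 ≤ c'') :
    ∃ C : ℝ, 0 < C ∧ (R.WF2 → ∃ c₃' : ℝ, 0 < c₃' ∧ ∃ U₀' : ℝ, 0 < U₀' ∧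
      ∀ (G : GeoConsts) (P : SplitConsts) (Q : EngConsts) (cc : ℝ), 0 < cc → cc ≤ klEngC₃6 P R → cc ≤ c₃' →
      ∀ μ ∈ klWindowC, ∀ U : ℝ, 0 < U → U ≤ min (klEngU₀3 P R cc) (1 / (R.Gfr 3 + 1)) → U ≤ U₀' → c'' * U ≤ 1 →
      ∀ β : ℝ, klBetaMin ≤ β → β ≤ Real.exp (cc / U ^ 2) →
      ∀ (L M : ℕ) [NeZero L] [NeZero M], klEngL₃ β U ≤ L → klEngM₃ β U L ≤ M →
      ∀ n : ℕ, 1 ≤ n → n ≤ nScales β + 1 → IsKLRegime U cc (-(n : ℤ)) → HistP klPredsV17F2 L M G P Q R β U μ 0 n →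
        (∀ m', 1 ≤ m' → m' < n → FlowPieceOscAt L M c'' β U μ m') →
        ∀ k J' : ℕ, k + 1 ≤ J' → J' ≤ n →
        ∀ T : HubbardGrassmann L M,
          (∀ (m' : ℕ) (X : Fin m' → HubbardFieldIdx L M), ∑ i, signedMomentum L (X i).2 (X i).1.1.2 ≠ 0 → kernel ℂ T m' X = 0) →
        ∀ j : ℕ, J' ≤ j → ∀ (q : Fin (m + 1)) (w : SpaceTimeIdx L M × SectorLeg (sectorCount J')) (N : ℝ), 0 ≤ N →
          (∀ w' : SpaceTimeIdx L M × SectorLeg (sectorCount k),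
            klWtPinnedSumAt L M β μ (klFlowFrameU L M β U μ n) k j (m + 1) T q w' ≤ N) →
          klWtPinnedSumAt L M β μ (klFlowFrameU L M β U μ n) J' j (m + 1) T q w ≤ C * ((2 : ℝ) ^ (J' - k)) ^ (m - 1) * N) := by
  obtain ⟨CJ, hCJ, hov⟩ := overlapWt_jump_sums_klEng_flow_all R c'' hc''
  obtain ⟨D, hD, hreg⟩ := card_relCount_prescribed_lastLeg_klAniso_le_window m
  refine ⟨(3 * CJ / 2) ^ (m + 1) * (D * 27 ^ (m + 1)), by positivity, fun hR2 => ?_⟩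
  have hRj : ∀ j, 0 ≤ R.Gfr j := gfr_nonneg_of_wf2 hR2
  obtain ⟨c₃, hc₃, U₀, hU₀, hcnt⟩ := hreg R hRj
  refine ⟨c₃, hc₃, U₀, hU₀, ?_⟩
  intro G P Q cc hcc hcc6 hcc₃' μ hμ U hU hUle hU₀' hcU β hβmin hβc L M _ _ hL3 hM3 n hn1 hnN hkl hhist hosc k J' hJ hJn T hT j hjJ q w N hN0 hN
  have hβ : 0 < β := KLRegimeSplit.pos_of_klBetaMin_le hβmin
  set K : TrigPolyC4v := klFlowFrameU L M β U μ n with hK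
  have hfr : FrameOK R U (nScales β) μ K := frameOK_klFlowFrameU_of_histP_le hR2 hn1 le_rfl hnN hhist
  obtain ⟨_, hcolJ, hrowJ⟩ := hov G P Q cc hR2 hcc hcc6 μ hμ U hU hUle hcU β hβmin hβc L M hL3 hM3 n hn1 hnN hkl hhist hosc k J' hJ hJn
  have hc₁0 : (0 : ℝ) ≤ 3 * CJ * M / β := by positivity
  have hcol₁ : ∀ (ω'' : Fin (sectorCount J')) (ω' : Fin (sectorCount k)) (σ c : Fin 2) (x' : SpaceTimeIdx L M),
      ∑ x'' : SpaceTimeIdx L M, ‖(sectorAnalysisMatrix L M β (klAnisoFamily L M β μ K klE0 J') *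
        sectorSubMatrix L M β (bgmFatMultiplier L M klE0 β (nambuXiCT L μ K) k)) (x'', ((ω'', σ), c)) (x', ((ω', σ), c))‖ *
          klScaleWt L M β j
            {latticeLegPos (2 * (2 * M)) ((x'', ((ω'', σ), c)) : SpaceTimeIdx L M × SectorLeg (sectorCount J')),
              latticeLegPos (2 * (2 * M)) ((x', ((ω', σ), c)) : SpaceTimeIdx L M × SectorLeg (sectorCount k))} ≤ 3 * CJ * M / β := by
    intro ω'' ω' σ c x'
    refine le_trans (sum_le_sum fun x'' _ => mul_le_mul_of_nonneg_left (klScaleWt_le_of_le β hjJ _) (norm_nonneg _)) ?_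
    exact hcolJ ω'' ω' σ c x'
  have hrow₁ : ∀ (ω'' : Fin (sectorCount J')) (ω' : Fin (sectorCount k)) (σ c : Fin 2) (x'' : SpaceTimeIdx L M),
      ∑ x' : SpaceTimeIdx L M, ‖(sectorAnalysisMatrix L M β (klAnisoFamily L M β μ K klE0 J') *
        sectorSubMatrix L M β (bgmFatMultiplier L M klE0 β (nambuXiCT L μ K) k)) (x'', ((ω'', σ), c)) (x', ((ω', σ), c))‖ *
          klScaleWt L M β j
            {latticeLegPos (2 * (2 * M)) ((x'', ((ω'', σ), c)) : SpaceTimeIdx L M × SectorLeg (sectorCount J')),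
              latticeLegPos (2 * (2 * M)) ((x', ((ω', σ), c)) : SpaceTimeIdx L M × SectorLeg (sectorCount k))} ≤ 3 * CJ * M / β := by
    intro ω'' ω' σ c x''
    refine le_trans (sum_le_sum fun x' _ => mul_le_mul_of_nonneg_left (klScaleWt_le_of_le β hjJ _) (norm_nonneg _)) ?_
    exact hrowJ ω'' ω' σ c x''
  have hJN : J' ≤ nScales β + 1 := hJn.trans hnN
  have h := klWtPinnedSumAt_jump_le_of_consts hβ μ K hJ T hT j hc₁0 hc₁0 hD.le hcol₁ hrow₁ m
    (fun E τ'' σ' => hcnt cc hcc hcc₃' U hU hU₀' β hβmin hβc μ hμ μ K hfr L M k J' (by omega) _ subset_rfl E τ'' σ') q w hN0 hN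
  have hMne : (M : ℝ) ≠ 0 := by exact_mod_cast NeZero.ne M
  have hεc : imagTimeWeight β M * (3 * CJ * M / β) = 3 * CJ / 2 := by
    unfold imagTimeWeight; field_simp
  have hconst : (3 * CJ * M / β) ^ m * (3 * CJ * M / β) * imagTimeWeight β M ^ (m + 1) = (3 * CJ / 2) ^ (m + 1) := by
    rw [← pow_succ, ← mul_pow, mul_comm (3 * CJ * M / β), hεc]
  calc klWtPinnedSumAt L M β μ K J' j (m + 1) T q w
      ≤ (3 * CJ * M / β) ^ m * (3 * CJ * M / β) * imagTimeWeight β M ^ (m + 1) * (D * 27 ^ (m + 1)) *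
          ((2 : ℝ) ^ (J' - k)) ^ (m - 1) * N := h
    _ = (3 * CJ / 2) ^ (m + 1) * (D * 27 ^ (m + 1)) * ((2 : ℝ) ^ (J' - k)) ^ (m - 1) * N := by rw [hconst]

/-- **THE INCREMENT `Δ_{k′}` RE-MEASURED AT `F_{dk−1}`, weighted track, flow frame, NO depth window** (`k′ < k`, `2 ≤ d`, `dk − 1 ≤ n`, rate `j ≥ dk − 1`):
`klWtPinnedSumAt … (dk−1) j (m+1) Δ_{k′} q w ≤ C_m·(2^{(dk−1)−dk′})^{m−1}·klTowerBornWtAt … d k′ j (m+1)` — the window-free twin of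
`klWtPinnedSumAt_klTowerIncr_remeasure_le_klEng_flow_deep`. [cite: BenfattoGiulianiMastropietro2006, §2.8 (2.82)-(2.84), (2.88)-(2.90)] -/
theorem klWtPinnedSumAt_klTowerIncr_remeasure_le_klEng_flow_all (m : ℕ) (R : RenConsts) (c'' : ℝ) (hc'' : 0 ≤ c'') :
    ∃ C : ℝ, 0 < C ∧ (R.WF2 → ∃ c₃' : ℝ, 0 < c₃' ∧ ∃ U₀' : ℝ, 0 < U₀' ∧
      ∀ (G : GeoConsts) (P : SplitConsts) (Q : EngConsts) (cc : ℝ), 0 < cc → cc ≤ klEngC₃6 P R → cc ≤ c₃' →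
      ∀ μ ∈ klWindowC, ∀ U : ℝ, 0 < U → U ≤ min (klEngU₀3 P R cc) (1 / (R.Gfr 3 + 1)) → U ≤ U₀' → c'' * U ≤ 1 →
      ∀ β : ℝ, klBetaMin ≤ β → β ≤ Real.exp (cc / U ^ 2) →
      ∀ (L M : ℕ) [NeZero L] [NeZero M], klEngL₃ β U ≤ L → klEngM₃ β U L ≤ M →
      ∀ n : ℕ, 1 ≤ n → n ≤ nScales β + 1 → IsKLRegime U cc (-(n : ℤ)) → HistP klPredsV17F2 L M G P Q R β U μ 0 n →
        (∀ m', 1 ≤ m' → m' < n → FlowPieceOscAt L M c'' β U μ m') →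
        ∀ d k k' : ℕ, 2 ≤ d → k' < k → d * k - 1 ≤ n →
        ∀ j : ℕ, d * k - 1 ≤ j → ∀ (q : Fin (m + 1)) (w : SpaceTimeIdx L M × SectorLeg (sectorCount (d * k - 1))),
          klWtPinnedSumAt L M β μ (klFlowFrameU L M β U μ n) (d * k - 1) j (m + 1)
              (klTowerIncr L M β U μ (klFlowFrameU L M β U μ n) d k') q w ≤
            C * ((2 : ℝ) ^ (d * k - 1 - d * k')) ^ (m - 1) *
              klTowerBornWtAt L M β U μ (klFlowFrameU L M β U μ n) d k' j (m + 1)) := by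
  obtain ⟨C, hC, h⟩ := klWtPinnedSumAt_jump_le_klEng_flow_all m R c'' hc''
  refine ⟨C, hC, fun hR2 => ?_⟩
  obtain ⟨c₃, hc₃, U₀, hU₀, h'⟩ := h hR2
  refine ⟨c₃, hc₃, U₀, hU₀, ?_⟩
  intro G P Q cc hcc hcc6 hcc₃' μ hμ U hU hUle hU₀' hcU β hβmin hβc L M _ _ hL3 hM3 n hn1 hnN hkl hhist hosc d k k' hd hk hkn j hj q w
  have hβ : 0 < β := KLRegimeSplit.pos_of_klBetaMin_le hβmin
  exact h' G P Q cc hcc hcc6 hcc₃' μ hμ U hU hUle hU₀' hcU β hβmin hβc L M hL3 hM3 n hn1 hnN hkl hhist hosc (d * k') (d * k - 1) (block_jump_le hd hk) hkn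
    (klTowerIncr L M β U μ _ d k') (fun m' X hX => klTowerIncr_momentumConserving β U μ _ d k' m' X hX) j hj q w
    (klTowerBornWtAt L M β U μ _ d k' j (m + 1)) (klTowerBornWtAt_nonneg hβ.le U μ _ d k' j (m + 1))
    (fun w' => klWtPinnedSumAt_le_klTowerBornWtAt β U μ _ d k' j (m + 1) q w')

/-! ## §2 The weighted jump with the second conservation gain, no window -/

/-- **THE WEIGHTED JUMP WITH THE SECOND CONSERVATION GAIN AT THE FLOW FRAME, NO DEPTH WINDOW** (`6 ≤ m + 1` legs): the window-free twin of
`klWtPinnedSumAt_jump_le_klEng_flow_deep_abs` — `klWtPinnedSumAt … J′ j (m+1) T q w ≤ C_m·(2^{J′})^{m−2}·N` at `K = K_n`, every `k + 1 ≤ J′ ≤ n`, ABSOLUTE in `J′`.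
[cite: BenfattoGiulianiMastropietro2006, §2.8 (2.82)-(2.84), (2.88)-(2.90); BenfattoGiulianiMastropietro2003, §3.1 Lemma 3.1 (4.3)] -/
theorem klWtPinnedSumAt_jump_le_klEng_flow_all_abs (m : ℕ) (hm : 5 ≤ m) (R : RenConsts) (c'' : ℝ) (hc'' : 0 ≤ c'') :
    ∃ C : ℝ, 0 < C ∧ (R.WF2 → ∃ c₃' : ℝ, 0 < c₃' ∧ ∃ U₀' : ℝ, 0 < U₀' ∧
      ∀ (G : GeoConsts) (P : SplitConsts) (Q : EngConsts) (cc : ℝ), 0 < cc → cc ≤ klEngC₃6 P R → cc ≤ c₃' →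
      ∀ μ ∈ klWindowC, ∀ U : ℝ, 0 < U → U ≤ min (klEngU₀3 P R cc) (1 / (R.Gfr 3 + 1)) → U ≤ U₀' → c'' * U ≤ 1 →
      ∀ β : ℝ, klBetaMin ≤ β → β ≤ Real.exp (cc / U ^ 2) →
      ∀ (L M : ℕ) [NeZero L] [NeZero M], klEngL₃ β U ≤ L → klEngM₃ β U L ≤ M →
      ∀ n : ℕ, 1 ≤ n → n ≤ nScales β + 1 → IsKLRegime U cc (-(n : ℤ)) → HistP klPredsV17F2 L M G P Q R β U μ 0 n →
        (∀ m', 1 ≤ m' → m' < n → FlowPieceOscAt L M c'' β U μ m') →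
        ∀ k J' : ℕ, k + 1 ≤ J' → J' ≤ n →
        ∀ T : HubbardGrassmann L M,
          (∀ (m' : ℕ) (X : Fin m' → HubbardFieldIdx L M), ∑ i, signedMomentum L (X i).2 (X i).1.1.2 ≠ 0 → kernel ℂ T m' X = 0) →
        ∀ j : ℕ, J' ≤ j → ∀ (q : Fin (m + 1)) (w : SpaceTimeIdx L M × SectorLeg (sectorCount J')) (N : ℝ), 0 ≤ N →
          (∀ w' : SpaceTimeIdx L M × SectorLeg (sectorCount k),
            klWtPinnedSumAt L M β μ (klFlowFrameU L M β U μ n) k j (m + 1) T q w' ≤ N) →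
          klWtPinnedSumAt L M β μ (klFlowFrameU L M β U μ n) J' j (m + 1) T q w ≤ C * ((2 : ℝ) ^ J') ^ (m - 2) * N) := by
  obtain ⟨CJ, hCJ, hov⟩ := overlapWt_jump_sums_klEng_flow_all R c'' hc''
  obtain ⟨D, hD, hreg⟩ := klWtPinnedSumAt_jump_le_of_overlap_abs
  refine ⟨(3 * CJ / 2) ^ (m + 1) * (D ^ (m + 1) * 27 ^ (m + 1)), by positivity, fun hR2 => ?_⟩
  have hRj : ∀ j, 0 ≤ R.Gfr j := gfr_nonneg_of_wf2 hR2
  obtain ⟨c₃, hc₃, U₀, hU₀, hjump⟩ := hreg R hRj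
  refine ⟨c₃, hc₃, U₀, hU₀, ?_⟩
  intro G P Q cc hcc hcc6 hcc₃' μ hμ U hU hUle hU₀' hcU β hβmin hβc L M _ _ hL3 hM3 n hn1 hnN hkl hhist hosc k J' hJ hJn T hT j hjJ q w N hN0 hN
  have hβ : 0 < β := KLRegimeSplit.pos_of_klBetaMin_le hβmin
  set K : TrigPolyC4v := klFlowFrameU L M β U μ n with hK
  have hfr : FrameOK R U (nScales β) μ K := frameOK_klFlowFrameU_of_histP_le hR2 hn1 le_rfl hnN hhist
  obtain ⟨_, hcolJ, hrowJ⟩ := hov G P Q cc hR2 hcc hcc6 μ hμ U hU hUle hcU β hβmin hβc L M hL3 hM3 n hn1 hnN hkl hhist hosc k J' hJ hJn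
  have hc₁0 : (0 : ℝ) ≤ 3 * CJ * M / β := by positivity
  have hcol₁ : ∀ (ω'' : Fin (sectorCount J')) (ω' : Fin (sectorCount k)) (σ c : Fin 2) (x' : SpaceTimeIdx L M),
      ∑ x'' : SpaceTimeIdx L M, ‖(sectorAnalysisMatrix L M β (klAnisoFamily L M β μ K klE0 J') *
        sectorSubMatrix L M β (bgmFatMultiplier L M klE0 β (nambuXiCT L μ K) k)) (x'', ((ω'', σ), c)) (x', ((ω', σ), c))‖ *
          klScaleWt L M β j
            {latticeLegPos (2 * (2 * M)) ((x'', ((ω'', σ), c)) : SpaceTimeIdx L M × SectorLeg (sectorCount J')),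
              latticeLegPos (2 * (2 * M)) ((x', ((ω', σ), c)) : SpaceTimeIdx L M × SectorLeg (sectorCount k))} ≤ 3 * CJ * M / β := by
    intro ω'' ω' σ c x'
    refine le_trans (sum_le_sum fun x'' _ => mul_le_mul_of_nonneg_left (klScaleWt_le_of_le β hjJ _) (norm_nonneg _)) ?_
    exact hcolJ ω'' ω' σ c x'
  have hrow₁ : ∀ (ω'' : Fin (sectorCount J')) (ω' : Fin (sectorCount k)) (σ c : Fin 2) (x'' : SpaceTimeIdx L M),
      ∑ x' : SpaceTimeIdx L M, ‖(sectorAnalysisMatrix L M β (klAnisoFamily L M β μ K klE0 J') *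
        sectorSubMatrix L M β (bgmFatMultiplier L M klE0 β (nambuXiCT L μ K) k)) (x'', ((ω'', σ), c)) (x', ((ω', σ), c))‖ *
          klScaleWt L M β j
            {latticeLegPos (2 * (2 * M)) ((x'', ((ω'', σ), c)) : SpaceTimeIdx L M × SectorLeg (sectorCount J')),
              latticeLegPos (2 * (2 * M)) ((x', ((ω', σ), c)) : SpaceTimeIdx L M × SectorLeg (sectorCount k))} ≤ 3 * CJ * M / β := by
    intro ω'' ω' σ c x''
    refine le_trans (sum_le_sum fun x' _ => mul_le_mul_of_nonneg_left (klScaleWt_le_of_le β hjJ _) (norm_nonneg _)) ?_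
    exact hrowJ ω'' ω' σ c x''
  have h := hjump cc hcc hcc₃' U hU hU₀' β hβmin hβc μ hμ μ K hfr L M k J' hJ T hT j _ _ hc₁0 hc₁0 hcol₁ hrow₁ m hm q w N hN0 hN
  have hMne : (M : ℝ) ≠ 0 := by exact_mod_cast NeZero.ne M
  have hεc : imagTimeWeight β M * (3 * CJ * M / β) = 3 * CJ / 2 := by
    unfold imagTimeWeight; field_simp
  have hconst : (3 * CJ * M / β) ^ m * (3 * CJ * M / β) * imagTimeWeight β M ^ (m + 1) = (3 * CJ / 2) ^ (m + 1) := by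
    rw [← pow_succ, ← mul_pow, mul_comm (3 * CJ * M / β), hεc]
  calc klWtPinnedSumAt L M β μ K J' j (m + 1) T q w
      ≤ (3 * CJ * M / β) ^ m * (3 * CJ * M / β) * imagTimeWeight β M ^ (m + 1) * (D ^ (m + 1) * 27 ^ (m + 1)) *
          ((2 : ℝ) ^ J') ^ (m - 2) * N := h
    _ = (3 * CJ / 2) ^ (m + 1) * (D ^ (m + 1) * 27 ^ (m + 1)) * ((2 : ℝ) ^ J') ^ (m - 2) * N := by rw [hconst]

/-- **THE UV SUMMAND `𝒱_0[K_n]` RE-MEASURED AT `F_{J′}`, weighted track, second conservation gain, flow frame, NO depth window** (`1 ≤ J′ ≤ n`, rate `j ≥ J′`):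
`klWtPinnedSumAt … J′ j (m+1) 𝒱_0 q w ≤ C_m·(2^{J′})^{m−2}·N₀` whenever the level-`0` weighted carriers `klWtPinnedSum … K_n 0 (m+1) q w′` are `≤ N₀`.
[cite: BenfattoGiulianiMastropietro2006, §2.8 (2.82)-(2.84); BenfattoGiulianiMastropietro2003, §3.1 Lemma 3.1 (4.3)] -/
theorem klWtPinnedSumAt_scaleZero_remeasure_le_klEng_flow_all_abs (m : ℕ) (hm : 5 ≤ m) (R : RenConsts) (c'' : ℝ) (hc'' : 0 ≤ c'') :
    ∃ C : ℝ, 0 < C ∧ (R.WF2 → ∃ c₃' : ℝ, 0 < c₃' ∧ ∃ U₀' : ℝ, 0 < U₀' ∧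
      ∀ (G : GeoConsts) (P : SplitConsts) (Q : EngConsts) (cc : ℝ), 0 < cc → cc ≤ klEngC₃6 P R → cc ≤ c₃' →
      ∀ μ ∈ klWindowC, ∀ U : ℝ, 0 < U → U ≤ min (klEngU₀3 P R cc) (1 / (R.Gfr 3 + 1)) → U ≤ U₀' → c'' * U ≤ 1 →
      ∀ β : ℝ, klBetaMin ≤ β → β ≤ Real.exp (cc / U ^ 2) →
      ∀ (L M : ℕ) [NeZero L] [NeZero M], klEngL₃ β U ≤ L → klEngM₃ β U L ≤ M →
      ∀ n : ℕ, 1 ≤ n → n ≤ nScales β + 1 → IsKLRegime U cc (-(n : ℤ)) → HistP klPredsV17F2 L M G P Q R β U μ 0 n →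
        (∀ m', 1 ≤ m' → m' < n → FlowPieceOscAt L M c'' β U μ m') →
        ∀ J' : ℕ, 1 ≤ J' → J' ≤ n →
        ∀ j : ℕ, J' ≤ j → ∀ (q : Fin (m + 1)) (w : SpaceTimeIdx L M × SectorLeg (sectorCount J')) (N₀ : ℝ), 0 ≤ N₀ →
          (∀ w' : SpaceTimeIdx L M × SectorLeg (sectorCount 0),
            klWtPinnedSum L M β U μ (klFlowFrameU L M β U μ n) 0 (m + 1) q w' ≤ N₀) →
          klWtPinnedSumAt L M β μ (klFlowFrameU L M β U μ n) J' j (m + 1)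
              (klEffectiveAction L M β U μ (klFlowFrameU L M β U μ n) klE0 0) q w ≤ C * ((2 : ℝ) ^ J') ^ (m - 2) * N₀) := by
  obtain ⟨C, hC, h⟩ := klWtPinnedSumAt_jump_le_klEng_flow_all_abs m hm R c'' hc''
  refine ⟨C, hC, fun hR2 => ?_⟩
  obtain ⟨c₃, hc₃, U₀, hU₀, h'⟩ := h hR2
  refine ⟨c₃, hc₃, U₀, hU₀, ?_⟩
  intro G P Q cc hcc hcc6 hcc₃' μ hμ U hU hUle hU₀' hcU β hβmin hβc L M _ _ hL3 hM3 n hn1 hnN hkl hhist hosc J' hJ1 hJn j hjJ q w N₀ hN0 hN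
  have hβ : 0 < β := KLRegimeSplit.pos_of_klBetaMin_le hβmin
  set K : TrigPolyC4v := klFlowFrameU L M β U μ n with hK
  refine h' G P Q cc hcc hcc6 hcc₃' μ hμ U hU hUle hU₀' hcU β hβmin hβc L M hL3 hM3 n hn1 hnN hkl hhist hosc 0 J' (by omega) hJn
    (klEffectiveAction L M β U μ K klE0 0) (klEffectiveAction_momentumConserving β U μ K klE0 0) j hjJ q w N₀ hN0 fun w' => ?_
  calc klWtPinnedSumAt L M β μ K 0 j (m + 1) (klEffectiveAction L M β U μ K klE0 0) q w'
      ≤ klWtPinnedSumOf L M β μ K 0 (m + 1) (klEffectiveAction L M β U μ K klE0 0) q w' :=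
        klWtPinnedSumAt_le_klWtPinnedSumOf hβ.le μ K (Nat.zero_le j) (m + 1) _ q w'
    _ = klWtPinnedSum L M β U μ K 0 (m + 1) q w' := klWtPinnedSumOf_klEffectiveAction β U μ K 0 (m + 1) q w'
    _ ≤ N₀ := hN w'

/-- **THE INCREMENT `Δ_{k′}` RE-MEASURED AT `F_{dk−1}` WITH THE SECOND CONSERVATION GAIN, weighted track, flow frame, NO depth window** (`k′ < k`, `2 ≤ d`,
`dk − 1 ≤ n`, rate `j ≥ dk − 1`, `5 ≤ m`; load-bearing at `k′ = 0`, where `Δ_0` is born at `F_0`):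
`klWtPinnedSumAt … (dk−1) j (m+1) Δ_{k′} q w ≤ C_m·(2^{dk−1})^{m−2}·klTowerBornWtAt … d k′ j (m+1)`.
[cite: BenfattoGiulianiMastropietro2006, §2.8 (2.82)-(2.84), (2.88)-(2.90); BenfattoGiulianiMastropietro2003, §3.1 Lemma 3.1 (4.3)] -/
theorem klWtPinnedSumAt_klTowerIncr_remeasure_le_klEng_flow_all_abs (m : ℕ) (hm : 5 ≤ m) (R : RenConsts) (c'' : ℝ) (hc'' : 0 ≤ c'') :
    ∃ C : ℝ, 0 < C ∧ (R.WF2 → ∃ c₃' : ℝ, 0 < c₃' ∧ ∃ U₀' : ℝ, 0 < U₀' ∧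
      ∀ (G : GeoConsts) (P : SplitConsts) (Q : EngConsts) (cc : ℝ), 0 < cc → cc ≤ klEngC₃6 P R → cc ≤ c₃' →
      ∀ μ ∈ klWindowC, ∀ U : ℝ, 0 < U → U ≤ min (klEngU₀3 P R cc) (1 / (R.Gfr 3 + 1)) → U ≤ U₀' → c'' * U ≤ 1 →
      ∀ β : ℝ, klBetaMin ≤ β → β ≤ Real.exp (cc / U ^ 2) →
      ∀ (L M : ℕ) [NeZero L] [NeZero M], klEngL₃ β U ≤ L → klEngM₃ β U L ≤ M →
      ∀ n : ℕ, 1 ≤ n → n ≤ nScales β + 1 → IsKLRegime U cc (-(n : ℤ)) → HistP klPredsV17F2 L M G P Q R β U μ 0 n →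
        (∀ m', 1 ≤ m' → m' < n → FlowPieceOscAt L M c'' β U μ m') →
        ∀ d k k' : ℕ, 2 ≤ d → k' < k → d * k - 1 ≤ n →
        ∀ j : ℕ, d * k - 1 ≤ j → ∀ (q : Fin (m + 1)) (w : SpaceTimeIdx L M × SectorLeg (sectorCount (d * k - 1))),
          klWtPinnedSumAt L M β μ (klFlowFrameU L M β U μ n) (d * k - 1) j (m + 1)
              (klTowerIncr L M β U μ (klFlowFrameU L M β U μ n) d k') q w ≤
            C * ((2 : ℝ) ^ (d * k - 1)) ^ (m - 2) * klTowerBornWtAt L M β U μ (klFlowFrameU L M β U μ n) d k' j (m + 1)) := by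
  obtain ⟨C, hC, h⟩ := klWtPinnedSumAt_jump_le_klEng_flow_all_abs m hm R c'' hc''
  refine ⟨C, hC, fun hR2 => ?_⟩
  obtain ⟨c₃, hc₃, U₀, hU₀, h'⟩ := h hR2
  refine ⟨c₃, hc₃, U₀, hU₀, ?_⟩
  intro G P Q cc hcc hcc6 hcc₃' μ hμ U hU hUle hU₀' hcU β hβmin hβc L M _ _ hL3 hM3 n hn1 hnN hkl hhist hosc d k k' hd hk hkn j hj q w
  have hβ : 0 < β := KLRegimeSplit.pos_of_klBetaMin_le hβmin
  exact h' G P Q cc hcc hcc6 hcc₃' μ hμ U hU hUle hU₀' hcU β hβmin hβc L M hL3 hM3 n hn1 hnN hkl hhist hosc (d * k') (d * k - 1) (block_jump_le hd hk) hkn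
    (klTowerIncr L M β U μ _ d k') (fun m' X hX => klTowerIncr_momentumConserving β U μ _ d k' m' X hX) j hj q w
    (klTowerBornWtAt L M β U μ _ d k' j (m + 1)) (klTowerBornWtAt_nonneg hβ.le U μ _ d k' j (m + 1))
    (fun w' => klWtPinnedSumAt_le_klTowerBornWtAt β U μ _ d k' j (m + 1) q w')

end Summit.HubbardSuperconductivity.HubbardSuperconductivity.Theorems.EngineV8

end
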